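import Summits.AtomisticToContinuum.HydrodynamicLimit.Theses.WarmColdDichotomy
import Summits.AtomisticToContinuum.HydrodynamicLimit.Theorems.OneFlightGossipEngineEnergyCurrentTailsLevelCensusObjects
import Summits.AtomisticToContinuum.HydrodynamicLimit.Theorems.OneFlightGossipEngineEnergyCurrentTailsLevelCensusTransfer
import Summits.AtomisticToContinuum.HydrodynamicLimit.Theorems.OneFlightGossipEngineEnergyCurrentTailsLevelCensusLedger
import Summits.AtomisticToContinuum.HydrodynamicLimit.Theorems.OneFlightGossipEngineEnergyCurrentTailsLevelCensusClosure
import Literature.MathematicalPhysics.KineticTheory.HardSphereEulerProofs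
import HarnessLib

/-!
# Line `level-census-comparison` for the crux `EnergyCurrentTails` (stmt-AtomisticToContinuum-9235)
# — registered skeleton, LEAD seat c2 (v6, 2026-08-16): A, C, T LANDED, reduction `energyCurrentTails_of_contactChaos`
# LANDED (…LevelCensusReduction, p116061); open = F1, F2, F3 (crux-strength)

v4 (lead `prover-line-stmt-AtomisticToContinuum-9235-c2-0`): the §0 objects, the stub statements (as
named `Prop`s `CensusLedger`, `RateCeiling`, `MergeCeiling`, `SplitFloor`, `GaussianCensusBound`,
`QuarticMomentBound`) and the PROVED `comparison_principle` now live in the tree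
(`…Theorems.OneFlightGossipEngineEnergyCurrentTailsLevelCensusObjects`, p104410, namespace
`…Theorems.EnergyCurrentTailsLevelCensus`) and are IMPORTED here, so that every landed stub
`theorem stub_X : X` replaces its `sorry` below by `exact`.  Registered stubs (by `ledger workitem stub-add`,
additive — the item's skeleton slot is held by the sibling line `quartic_schur_ledger`):
`stub_censusLedger : CensusLedger` (A), `stub_rateCeiling : RateCeiling` (F1), `stub_mergeCeiling :
MergeCeiling` (F2), `stub_splitFloor : SplitFloor` (F3, hardest, lead), `stub_censusClosure : CensusLedger →
RateCeiling → MergeCeiling → SplitFloor → GaussianCensusBound` (C), `stub_censusTransfer : GaussianCensusBound →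
QuarticMomentBound` (T, proved §4), `comparison_principle` (landed).  The planner's v3 docstring follows.

# Line `level-census-comparison` for the crux `EnergyCurrentTails` (stmt-AtomisticToContinuum-9235)
# — registered skeleton, crux-plan round 1

Crux (route `OneFlightGossipEngine`, rank 9; the item's primary copy is the textually identical
`WarmColdDichotomy.EnergyCurrentTails`; shared by BallwiseInvariantReferences, AnosovDiceHopf,
TwoClocks, JaynesSqueeze, PesinPricing, ExpTailStaging): for continuous profiles `a₀, θ₀ > 0`, `u₀`
there is `σ₀ > 0` such that for `0 < σ < σ₀`, every classical hs-Euler solution on `[0,T)`, every flow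
family `Φ N` and local Gibbs data `λ_N` whose fields converge at `t = 0`:
`∀ t < T ∀ ε > 0 ∃ M ∃ N₀ ∀ N ≥ N₀ ∀ s ∈ [0,t], E_{λ_N}[(N+1)⁻¹ ∑ᵢ 𝟙{M < |vᵢ(s)|}|vᵢ(s)|³] ≤ ε`.

## The lever (idea card `Ideas/level-census-comparison.md`, triage sharpenings r1-1 §D, r1-2, r1-3)

COUNTS, NOT MOMENTS.  The expected LEVEL CENSUS `n_r(E) = E_{λ_N} #{i : ‖vᵢ(r)‖² > E}` changes only at
collisions, and ONE elastic collision changes the pair's count above `E` by `κ_E ∈ {−1, 0, +1}`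
(energy conservation forbids `±2`).  So the census obeys an exact LEDGER over the tree's collision records
(`HardSphereFlow.collisionSum`): `n_{s′}(E) + D(s,s′](E) = n_s(E) + U(s,s′](E)`, with `U`/`D` the expected
numbers of up- and down-crossing collisions at level `E` in the window; carrier changes (dead-centre hops,
triage r1-3 `deadCentre_swap`) have `κ_E = 0` and are invisible.  The kinematics is ASYMMETRIC
(`upStep_le_partner_normal_energy`, §1, proved): in an up-crossing either some participant had pre-energy
in the BAND `(E−Δ, E]` — then nothing about geometry is needed, only a collision-RATE CEILING for band
particles (stub F1) — or both partners were Δ-energetic (merge) / the fast partner was above `E`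
(spallation): a PAIR event, priced by a one-sided no-affinity ceiling, quadratic in the census (stub F2);
while a δ-splitting encounter of a particle in `(E, 3E/2]` is a down-crossing (both outgoing energies
`≤ E`), and such encounters happen at a fixed fraction of the Boltzmann rate (stub F3, the loss floor).
Written in CONTINUOUS TIME (crossing counts over short windows, populations as sup/inf over the window —
triage r1-1 §D / r1-2: the discrete one-window form of the card's `census_comparison` needs the CFL
condition `C + c ≤ 1`, false because per-window coefficients grow like `√E`), the common factor
`κ_N √E` (`κ_N = σ²(N+1)^{1/3}`, the collision clock) multiplies drift, decay and merge alike and CANCELS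
in the supersolution inequality: an exponential barrier `b(E) = β(N+1)e^{−αE}E^{−3/2}`, anchored at the
base level `E₀` on the Chebyshev bound `(N+1)m₂/E₀` (energy conservation), is a strict supersolution for
`Δ ≫ m₂`, `E₀ = RΔ`, `R ≫ C₁/c`, `α = L/E₀` (constants: docstring of stub C), and the continuous-time COMPARISON
PRINCIPLE (`comparison_principle`, §3, PROVED: first violation time + upward time-Lipschitz census +
strict decrease near touching ⇒ no violation; no CFL, no attainment of suprema needed) propagates it
for all `s ≤ t`, uniformly in `N`: the number of mean free times `t·κ_N → ∞` never enters.  The output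
is the card's transfer statement C⁺ = `GaussianCensusBound` (an exponential-in-energy expected census,
pointwise in `s` — Nachtergaele–Yau's cut-off II.1 in expectation form, the one currency on the board an
NY-type dock can eat, triage r1-1 ##3), which gives the uniform quartic moment by layer-cake (stub T,
PROVED here: `censusTransfer_proof`) and the crux by the LANDED Chebyshev docking
`…Theorems.LoschmidtTagging.stub_quarticDocking` (p92098).

## Stubs registered here (5 open; sorries ONLY in `Holds.stub_*`) + 1 proved (T)

* A  `stub_censusLedger`     — a-priori inputs, no chaos: the crossing ledger (identity), kinetic energy
     bound `E∑‖vᵢ(s)‖² ≤ (N+1)m₂` (conservation), Gaussian census of the datum and Gaussian total-energy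
     tail, a.e.-measurability of velocity-event counts.  Provable now; L-sized.
* F1 `stub_rateCeiling`      — collision-rate CEILING for energetic shells / tails (count form of
     `CollisionActivityTails`; `C₁ = C₁(σ)`).  Dynamical, moderate.
* F2 `stub_mergeCeiling`     — one-sided NO-AFFINITY ceiling for merge/spallation up-crossings (pair events,
     quadratic census majorant over arithmetic energy classes).  Dynamical, crux-strength.
* F3 `stub_splitFloor`       — SPLITTING FLOOR: particles in `(E, 3E/2]` are knocked below `E` (both
     outgoing energies `≤ E`) at `≥ c κ_N √E` per unit time.  Dynamical, crux-strength — THE HARDEST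
     (= quartic-schur-ledger's S1 producer: `OneFlightLayeredChaos` for energetic projectiles).
* C  `stub_censusClosure`    — A → F1 → F2 → F3 → `GaussianCensusBound`: instantiate `comparison_principle`
     (§3) at fixed `N` with the barrier `β(N+1)e^{−αE}E^{−3/2}`; real analysis + bookkeeping.  Provable now; L.
* T  `stub_censusTransfer`   — `GaussianCensusBound → QuarticMomentBound` (layer-cake) — PROVED (§4,
     `censusTransfer_proof`: `lintegral_rpow_eq_lintegral_meas_lt_mul`, `τe^{−ατ} ≤ (2/α)e^{−ατ/2}`,
     `integral_exp_mul_Ioi`; constant `C = 2(max(E₀,1)² + 4B⁺/α²)`), so it is no longer an obligation.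

Composition (sorry-free): `EnergyCurrentTails_of : A → F1 → F2 → F3 → C →
WarmColdDichotomy.EnergyCurrentTails` (the item's primary decl, BY NAME) via `censusTransfer_proof` and the
Chebyshev docking `quarticDocking` (§4b, re-proved here from the landed
`…Theorems.LoschmidtTagging.stub_quarticDocking`, p92098, so that this file imports only
`Theses.WarmColdDichotomy` — the `OneFlightGossipEngine` copy of the decl is the textually identical `Prop`
and is docked by the landed theorem itself); the hypothesis-free `EnergyCurrentTails_proof` (modulo the five
open stubs).

## Disproof honoured (`Cruxes/EnergyCurrentTails/Disproof.lean`, cycle 1 final; `EquilibriumRung.lean`)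

* §3 `energyCurrentTails_false_without_randomness(_inDomain)` (H = randomness of the data): every stub
  is an EXPECTATION under `λ_N`; the only sure statement is the crossing ledger inside A, an identity.
  The witness `fastConfig` is admitted pathwise and excluded in expectation by A(iii) at `s = 0`.
* §4 `energyCurrentTails_false_of_quadraticUI_only` (H = more than quadratic UI): the line transfers UP to
  an exponential census (C⁺ is false for `twoPointLaw`: census `(N+1)^{1/2}·𝟙{E < N+1}` vs
  `β(N+1)e^{−αE}`); quadratic information (Chebyshev) only ANCHORS the barrier's prefactor at `E₀`, the
  decay above `E₀` is F3's (stub C uses A(ii) at the base level only).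
* §5 `reflectVel_focus`, `focusing_tree`, `cubicTail_not_nonincreasing` (no pathwise maximum principle):
  nothing pathwise is claimed monotone; the complete transfer is a MERGE/SPALLATION event (`κ_E = +1`
  with an energetic partner) priced by F2, and the ledger carries `U` explicitly.
* §6 `energyCurrentTailsExpMoment_false` + the LANDED `…Negative.CubicTailExpMoment` (checked against in the
  seat's scratch build; not imported here to keep the file on `Theses.WarmColdDichotomy` alone): no
  exponential MOMENT of the cubic functional anywhere — C⁺ bounds an expected COUNT (finite at `t = 0`
  for `α < 1/(2 max θ₀)`), and the crux is consumed by Chebyshev (`stub_quarticDocking`), Disproof §4(d).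
* `EquilibriumRung.energyCurrentTails_homogeneous` / the lead's landed `stub_equilibriumRung`: the
  constant-profile rung, where the census is stationary and F1–F3 hold with the Boltzmann fluxes of the
  card's falsifier (b).  `-- Targets` predicted: `stub_splitFloor` first (Disproof §7(i) loss floor).
* Negatives index (`ledger negatives`, 15 for the summit): none restated; in particular C⁺ is an expected
  COUNT, not the refuted exponential-PROBABILITY budget of `EulerCharacteristicsExpTailBudgetRefutation`.

References: Gamba–Panferov–Villani 2009 (the comparison principle transplanted: pointwise
upper-Maxwellian bounds, ARMA 194), Bobylev 1997, Bobylev–Gamba–Panferov 2004, Mischler–Wennberg 1999,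
Alonso–Cañizo–Gamba–Mouhot 2013 (Boltzmann tail theory by moments — what is NOT done here);
Mischler–Mouhot 2013 (uniform-in-`N` estimates for the stochastic `N`-particle process, the twin);
Nachtergaele–Yau 2003 §2.3/§7.2 and Olla–Varadhan–Yau 1993 §5 (cut-off II.1, the target currency);
Cercignani–Illner–Pulvirenti 1994 §4 (collision records of the flow).
-/
noncomputable section

open MeasureTheory Set Filter
open scoped ENNReal InnerProductSpace

namespace Summit.AtomisticToContinuum.HydrodynamicLimit.Cruxes.EnergyCurrentTails.LevelCensusComparison

open Literature.MathematicalPhysics.KineticTheory Literature.Analysis.FluidPDE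
open Summit.AtomisticToContinuum.HydrodynamicLimit.Theorems.EnergyCurrentTailsLevelCensus

/-! ## §0 Objects — LANDED (`…Theorems.EnergyCurrentTailsLevelCensus`: `Flow`, `VelEvent`, `clock`,
`levelCensus`, `shellCensus`, `speedCensus`, `kineticEnergy`, `eventSum`, `eventCount`, `aboveCount`,
`maxPre`, `upEvent`, `downEvent`, `shellEvent`, `tailEvent`, `splitEvent`, `mergeEvent`, `pairMajorant`). -/

/-! ## §1 The kinematic asymmetry behind the accounts (proved) -/

/-- Energy exchange (exact): `‖v′‖² = ‖v‖² − ⟪v,ω⟫² + ⟪w,ω⟫²` for a unit impact vector. [folklore] -/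
theorem norm_sq_reflectVel_fst (v w ω : V3) (hω : ‖ω‖ = 1) :
    ‖(reflectVel ω (v, w)).1‖ ^ 2 = ‖v‖ ^ 2 - ⟪v, ω⟫_ℝ ^ 2 + ⟪w, ω⟫_ℝ ^ 2 := by
  have h1 : ‖ω‖ ^ 2 = 1 := by rw [hω]; norm_num
  have hc : ⟪v - w, ω⟫_ℝ = ⟪v, ω⟫_ℝ - ⟪w, ω⟫_ℝ := inner_sub_left _ _ _
  simp only [reflectVel, h1, div_one]
  rw [norm_sub_sq_real, norm_smul, mul_pow, Real.norm_eq_abs, sq_abs, h1, inner_smul_right, hc]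
  ring

/-- Energy exchange (exact): `‖w′‖² = ‖w‖² + ⟪v,ω⟫² − ⟪w,ω⟫²`. [folklore] -/
theorem norm_sq_reflectVel_snd (v w ω : V3) (hω : ‖ω‖ = 1) :
    ‖(reflectVel ω (v, w)).2‖ ^ 2 = ‖w‖ ^ 2 + ⟪v, ω⟫_ℝ ^ 2 - ⟪w, ω⟫_ℝ ^ 2 := by
  have h1 : ‖ω‖ ^ 2 = 1 := by rw [hω]; norm_num
  have hc : ⟪v - w, ω⟫_ℝ = ⟪v, ω⟫_ℝ - ⟪w, ω⟫_ℝ := inner_sub_left _ _ _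
  simp only [reflectVel, h1, div_one]
  rw [norm_add_sq_real, norm_smul, mul_pow, Real.norm_eq_abs, sq_abs, h1, inner_smul_right, hc]
  ring

/-- **Up-steps are bounded by the partner's NORMAL energy** (the card's first lemma): in one elastic
collision `‖v′‖² − ‖v‖² = ⟪w,ω⟫² − ⟪v,ω⟫² ≤ ⟪w,ω⟫² ≤ ‖w‖²`.  Hence an up-crossing of level `E` against a
partner of energy `≤ Δ` starts in the band `(E − Δ, E]`, whatever the geometry — the reason the band
account needs only a RATE ceiling (F1) and everything else is a pair event (F2). [folklore] -/
theorem upStep_le_partner_normal_energy (v w ω : V3) (hω : ‖ω‖ = 1) :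
    ‖(reflectVel ω (v, w)).1‖ ^ 2 - ‖v‖ ^ 2 ≤ ⟪w, ω⟫_ℝ ^ 2 ∧ ⟪w, ω⟫_ℝ ^ 2 ≤ ‖w‖ ^ 2 := by
  refine ⟨?_, ?_⟩
  · rw [norm_sq_reflectVel_fst v w ω hω]
    nlinarith [sq_nonneg ⟪v, ω⟫_ℝ]
  · have h := abs_real_inner_le_norm w ω
    rw [hω, mul_one] at h
    nlinarith [abs_nonneg ⟪w, ω⟫_ℝ, sq_abs ⟪w, ω⟫_ℝ]

/-- **Down-steps are proportional**: the energy kept by `v` is `‖v‖²(1 − cos²ψ) + ⟪w,ω⟫²`, where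
`cos²ψ = ⟪v,ω⟫²/‖v‖²`; a δ-splitting geometry removes the fraction `cos²ψ` of `‖v‖²` at once. [folklore] -/
theorem energy_after_collision_eq (v w ω : V3) (hω : ‖ω‖ = 1) :
    ‖(reflectVel ω (v, w)).1‖ ^ 2 = (‖v‖ ^ 2 - ⟪v, ω⟫_ℝ ^ 2) + ⟪w, ω⟫_ℝ ^ 2 := by
  rw [norm_sq_reflectVel_fst v w ω hω]

/-- The pair's kinetic energy is conserved, so ONE collision moves the pair's count above any level by at
most one: `κ_E ∈ {−1, 0, 1}` (here: never two up-crossings at once). [folklore] -/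
theorem aboveCount_post_le_succ (E : ℝ) (v w ω : V3)
    (h : aboveCount E (v, w) = 0) : aboveCount E (reflectVel ω (v, w)) ≤ 1 := by
  -- both pre-energies are `≤ E`; the post-energies sum to the same total `≤ 2E`, so not both exceed `E`
  have hsum := norm_sq_reflectVel_fst_add_norm_sq_reflectVel_snd ω (v, w)
  simp only [aboveCount] at h ⊢
  have hv : ¬ E < ‖v‖ ^ 2 := by
    intro hv; simp [hv] at h
  have hw : ¬ E < ‖w‖ ^ 2 := by
    intro hw; simp [hw] at h
  push Not at hv hw
  by_cases h1 : E < ‖(reflectVel ω (v, w)).1‖ ^ 2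
  · by_cases h2 : E < ‖(reflectVel ω (v, w)).2‖ ^ 2
    · exfalso
      have : ‖(reflectVel ω (v, w)).1‖ ^ 2 + ‖(reflectVel ω (v, w)).2‖ ^ 2 = ‖v‖ ^ 2 + ‖w‖ ^ 2 := hsum
      linarith
    · simp [h1, h2]
  · by_cases h2 : E < ‖(reflectVel ω (v, w)).2‖ ^ 2
    · simp [h1, h2]
    · simp [h1, h2]

/-! ### The account inclusions used by stub C (proved; pure bookkeeping on velocity events) -/

/-- Splitting collisions are down-crossings: `splitEvent E ⊆ downEvent E`. -/
theorem splitEvent_subset_downEvent (E : ℝ) : splitEvent E ⊆ downEvent E := by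
  rintro ⟨⟨v, w⟩, ⟨v', w'⟩⟩ ⟨hmax, -, hv', hw'⟩
  simp only [downEvent, Set.mem_setOf_eq, aboveCount, maxPre] at *
  have h1 : ¬ E < ‖v'‖ ^ 2 := not_lt.2 hv'
  have h2 : ¬ E < ‖w'‖ ^ 2 := not_lt.2 hw'
  simp only [h1, h2, if_false, add_zero]
  rcases lt_max_iff.1 hmax with h | h
  · simp [h]
  · simp only [h, if_true]
    split <;> simp

/-- Every up-crossing at level `E` is in one of the three accounts: a participant in the band
`(E−Δ, E]` (F1), a merge/spallation pair event with faster participant `≤ 4E` (F2), or a collision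
involving a participant above `4E` (F1's tail). -/
theorem upEvent_subset_accounts (E Δ : ℝ) :
    upEvent E ⊆ shellEvent (E - Δ) E ∪ mergeEvent E Δ ∪ tailEvent (4 * E) := by
  intro q hq
  by_cases hb : q ∈ shellEvent (E - Δ) E
  · exact Or.inl (Or.inl hb)
  · by_cases ht : maxPre q ≤ 4 * E
    · exact Or.inl (Or.inr ⟨⟨hq, hb⟩, ht⟩)
    · exact Or.inr (not_le.1 ht)

/-- In an up-crossing of an ELASTIC collision the faster incoming sphere carries more than `E/2`
(energy conservation), so up-crossings at level `E` are collisions with a participant above `E/2` —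
the inclusion behind the time-Lipschitz constant of stub C (F1's tail at `Y = E/2`). -/
theorem half_lt_maxPre_of_upEvent (E : ℝ) (v w ω : V3)
    (h : ((v, w), reflectVel ω (v, w)) ∈ upEvent E) :
    E / 2 < maxPre ((v, w), reflectVel ω (v, w)) := by
  have hsum := norm_sq_reflectVel_fst_add_norm_sq_reflectVel_snd ω (v, w)
  simp only [upEvent, Set.mem_setOf_eq, aboveCount, maxPre] at h ⊢
  -- some outgoing energy exceeds `E`, hence the (conserved) total exceeds `E`
  have htot : E < ‖v‖ ^ 2 + ‖w‖ ^ 2 := by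
    by_contra hle
    push Not at hle
    have h1 : ¬ E < ‖(reflectVel ω (v, w)).1‖ ^ 2 := by
      intro h1
      by_cases h2 : E < ‖(reflectVel ω (v, w)).2‖ ^ 2
      · have : ‖(reflectVel ω (v, w)).1‖ ^ 2 + ‖(reflectVel ω (v, w)).2‖ ^ 2 = ‖v‖ ^ 2 + ‖w‖ ^ 2 :=
          hsum
        nlinarith [sq_nonneg ‖(reflectVel ω (v, w)).2‖]
      · push Not at h2
        have : ‖(reflectVel ω (v, w)).1‖ ^ 2 + ‖(reflectVel ω (v, w)).2‖ ^ 2 = ‖v‖ ^ 2 + ‖w‖ ^ 2 :=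
          hsum
        nlinarith [sq_nonneg ‖(reflectVel ω (v, w)).2‖]
    have h2 : ¬ E < ‖(reflectVel ω (v, w)).2‖ ^ 2 := by
      intro h2
      have : ‖(reflectVel ω (v, w)).1‖ ^ 2 + ‖(reflectVel ω (v, w)).2‖ ^ 2 = ‖v‖ ^ 2 + ‖w‖ ^ 2 :=
        hsum
      nlinarith [sq_nonneg ‖(reflectVel ω (v, w)).1‖]
    simp [h1, h2] at h
  rcases le_total (‖v‖ ^ 2) (‖w‖ ^ 2) with hvw | hvw
  · rw [max_eq_right hvw]; linarith
  · rw [max_eq_left hvw]; linarith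


/-! ## §2 Registered stubs — the open obligations (sorries ONLY in `Holds.stub_*`; statements are the
landed `Prop`s, docstrings there) -/

namespace Holds

/-- Stub A (census ledger + a-priori inputs) — LANDED (`…LevelCensusLedger`, p111677). -/
theorem stub_censusLedger : CensusLedger :=
  Summit.AtomisticToContinuum.HydrodynamicLimit.Theorems.EnergyCurrentTailsLevelCensus.stub_censusLedger

/-- Stub F1 (collision-rate ceiling for energetic shells and tails; dynamical). -/
theorem stub_rateCeiling : RateCeiling := by
  sorry

/-- Stub F2 (merge / spallation no-affinity ceiling; dynamical, crux-strength). -/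
theorem stub_mergeCeiling : MergeCeiling := by
  sorry

/-- Stub F3 (splitting floor; dynamical, crux-strength, THE HARDEST — lead). -/
theorem stub_splitFloor : SplitFloor := by
  sorry

/-- Stub C (census closure: `comparison_principle` instantiated at fixed `N`) — LANDED (`…LevelCensusClosure`,
p115200; helpers ClosureTools/Events/Barrier/Anchors/Merge/Spallation/Core/Frame). -/
theorem stub_censusClosure :
    CensusLedger → RateCeiling → MergeCeiling → SplitFloor → GaussianCensusBound :=
  Summit.AtomisticToContinuum.HydrodynamicLimit.Theorems.EnergyCurrentTailsLevelCensus.stub_censusClosure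

end Holds

/-! ## §3 The continuous-time comparison principle — LANDED (`EnergyCurrentTailsLevelCensus.comparison_principle`,
∀-form, p104410). -/

/-! ## §4 Stub T and the Chebyshev docking — LANDED (`…Theorems.OneFlightGossipEngineEnergyCurrentTailsLevelCensusTransfer`,
p109372: `EnergyCurrentTailsLevelCensus.stub_censusTransfer : GaussianCensusBound → QuarticMomentBound`,
`EnergyCurrentTailsLevelCensus.quarticDocking : QuarticMomentBound → WarmColdDichotomy.EnergyCurrentTails`,
`quarticDocking_oneFlight`, `energyCurrentTails_of_gaussianCensusBound`). -/

/-! ## §5 Composition (sorry-free): the five open stubs ⟹ the crux BY NAME -/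

/-- **THE SKELETON THEOREM** for the item's primary decl (`WarmColdDichotomy.EnergyCurrentTails`,
definitionally the same `Prop` as the `OneFlightGossipEngine` copy): the five registered stubs imply the
crux BY NAME — census closure to C⁺ (stub C), the PROVED layer-cake transfer (`stub_censusTransfer`, LANDED) and the Chebyshev docking (`quarticDocking`, LANDED). -/
theorem EnergyCurrentTails_of (hA : CensusLedger) (h₁ : RateCeiling) (h₂ : MergeCeiling) (h₃ : SplitFloor)
    (hC : CensusLedger → RateCeiling → MergeCeiling → SplitFloor → GaussianCensusBound) :
    Summit.AtomisticToContinuum.HydrodynamicLimit.Theses.WarmColdDichotomy.EnergyCurrentTails :=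
  quarticDocking (stub_censusTransfer (hC hA h₁ h₂ h₃))

/-- The same composition for the `OneFlightGossipEngine` copy of the crux (payload route of this line). -/
theorem EnergyCurrentTails_oneFlight_of (hA : CensusLedger) (h₁ : RateCeiling) (h₂ : MergeCeiling)
    (h₃ : SplitFloor) (hC : CensusLedger → RateCeiling → MergeCeiling → SplitFloor → GaussianCensusBound) :
    Summit.AtomisticToContinuum.HydrodynamicLimit.Theses.OneFlightGossipEngine.EnergyCurrentTails :=
  quarticDocking_oneFlight (stub_censusTransfer (hC hA h₁ h₂ h₃))

/-- **The line's closing theorem, modulo the five registered stubs** (sorry-free once they are): the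
declaration the gate probes. -/
theorem EnergyCurrentTails_proof :
    Summit.AtomisticToContinuum.HydrodynamicLimit.Theses.WarmColdDichotomy.EnergyCurrentTails :=
  EnergyCurrentTails_of Holds.stub_censusLedger Holds.stub_rateCeiling Holds.stub_mergeCeiling
    Holds.stub_splitFloor Holds.stub_censusClosure

end Summit.AtomisticToContinuum.HydrodynamicLimit.Cruxes.EnergyCurrentTails.LevelCensusComparison

end
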